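import Summits.HodgeConjecture.HodgeConjecture.Theorems.R90S10TorusCharGlobalise   -- ★ p01: `exists_isAutomorphic_torusLocalComponent_eq` + the whole currency (TorusDict, `torusLocalComponent`, `localUnitIdeles`)
import HarnessLib

/-!
# R90 · S10 — LETTER L-C′ `TorusCharExtendLetter L v`: a character of the compact local torus at a non-split `v` EXTENDS to an automorphic character of
# `U(1)(𝔸_{L⁺})` SPHERICAL OFF `v` (DEAL #54 (α); DEFS, 0 sorry)

Cell `hodgecm-mathlib`, crux H413 (`stmt-HodgeConjecture-24833`), route of record `HCCMUnconditional`; slab R90-TF, section S10 = §13.8; seat R90-C138-p06 (g0),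
DEAL #54 (α) (dealer R90-C138-plan (g3): «HEADS∕LETTER file … EXACTLY your head bytes (+ `_iff`), definition lane»).  Definition lane (`--kind definition --supports
stmt-HodgeConjecture-24833 --as helper`); statement layer only — ONE closed `def … : Prop` + its `Iff.rfl` read-back; no instance, no notation, no axiom, no `sorry`; ★-only
imports.  CONSUMERS: p01 (g0)'s A2a₂ payer ★-skeleton `realiseH₂_of_letters` (DEAL #44, letter `hC`: the `U(Φ₁)`-line `θ` must be UNRAMIFIED OFF `v` — my ★
`exists_flathBlockH`'s binder `hχθK`, p01's `hθχ`); PAYER: the A ED. 10 card (RULING on my census 02:50Z: road «★ TorusDictionary §45.13 WEIL EXTENSION WITH ONE FINITE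
COMPONENT» + my ★-bound brick B3 `exists_archExponents_compensating`).

THE MATHEMATICS [Rogawski1990 §13.8 p. 217 l. 9–12 «every character of `Π′𝒪_v^1` extends to a character of `E^1\E^1_𝔸` … `φ_w = φ′`»; Weil1956 §1; Arthur2011Draft
d-p. 310, d-p. 319 Remark 2].  `T = U(1) = ker(N_{L∕L⁺})`, `T(𝔸_{L⁺})` = ★ `TorusDict.torus c` (`c` = complex conjugation; norm-one idèles of `L`).  At a place `v` of
`L⁺` NOT split in `L` the local torus `T(L⁺_v) = L_w^1` is COMPACT and equals its integral points (★ §45.12 `valuation_eq_one_of_mem_torus`); a continuous character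
`χ_T` of it (★ `normOneUnits (conjLocal L c v)`, the `η`∕`ψ` slots of ★ `torusLocalComponent`) is the `v`-component of an AUTOMORPHIC `ψ` (★ `TorusDict.IsAutomorphic`)
which is moreover SPHERICAL at every finite `w ≠ v` (trivial on `T(𝒪_w) = T(𝔸) ∩ ∏_{W∣w} 𝒪_W^×`, ★ `IdeleHerbrand.localUnitIdeles`) and of SOME archimedean type
`(2e, 0)` (★ `HeckeCharacter.HasUnitaryArchType` of the base change ★ `TorusDict.pullback`, as in ★ `OneDimAutRepH.harchψ`): the character `(χ_T at v) ⊗ (1 off v) ⊗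
(Φ_{2e} at ∞)` of the level-one open subgroup `U = T_∞ · ∏_w T(𝒪_w)` kills `T(L⁺) ∩ U = μ(L)` (Kronecker, ★ §45.11) for a suitable `e` (brick B3: `μ(L)` is cyclic and
one embedding is a primitive root), so it descends to the finite-index (★ §45.10) image of `U` in `T(L⁺)\T(𝔸)` and extends.  The one-place version WITHOUT the
off-`v` control is ★ `exists_isAutomorphic_torusLocalComponent_eq` (p01, over [CHT08 L. 4.1.1]); the control is the content.  Why it might fail: at a place `w ≠ v`
RAMIFIED in `L∕L⁺` «spherical» in this idelic sense is the STRONG form (trivial on all of `T(𝒪_w)`, not only on `{ū∕u}` — ★ §45.9's sign); Weil's principle delivers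
it because the level subgroup is `∏_w T(𝒪_w)` itself — no slack.
HONEST LABEL: a letter pays nothing; HC_CM is proved only modulo the 7 printed citations (2 remaining named inputs: hLiu418 = stmt-HodgeConjecture-24832, h413 =
stmt-HodgeConjecture-24833) until rung 0 closes; REL ≠ ★ ≠ BUILT.

## References
* [Rogawski1990] J. D. Rogawski, *Automorphic Representations of Unitary Groups in Three Variables*, Ann. of Math. Stud. 123 (1990): §13.8 p. 217 l. 9–12, p. 218 L9.
* [Weil1956] A. Weil, *On a certain type of characters of the idèle-class group of an algebraic number-field*, Proc. Int. Symp. Tokyo–Nikko (1956), §1.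
* [Arthur2011Draft] J. Arthur, *The Endoscopic Classification of Representations* (2011 draft), d-p. 310, d-p. 319 Remark 2.
* [ClozelHarrisTaylor2008] L. Clozel, M. Harris, R. Taylor, Publ. Math. IHÉS 108 (2008), Lemma 4.1.1.
-/

set_option autoImplicit false
-- the mandated namespace repeats the single-problem summit's segment (`HodgeConjecture.HodgeConjecture`)
set_option linter.dupNamespace false

noncomputable section

open NumberField IsDedekindDomain
open Literature.NumberTheory.Rogawski1990 Literature.NumberTheory.Automorphic Literature.NumberTheory.Automorphic.UnitaryGroup
open Literature.NumberTheory.GaloisRepresentations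
open Literature.NumberTheory.Automorphic.Arthur2013.Leaves.TECR

namespace Summit.HodgeConjecture.HodgeConjecture.R90.S10

/-- **L-C′ `TorusCharExtendLetter L v`** — AT A PLACE `v` OF `L⁺` NOT SPLIT IN `L`: every continuous character `χ_T` of the local norm-one torus `T(L⁺_v)` (★
`normOneUnits (conjLocal L c v)`) is the `v`-component (★ `torusLocalComponent`) of an AUTOMORPHIC character `ψ` of `T(𝔸_{L⁺})` (★ `TorusDict.torus c`, ★
`TorusDict.IsAutomorphic`) which is SPHERICAL at every finite `w ≠ v` (trivial on the torus idèles supported and integral above `w`, ★ `IdeleHerbrand.localUnitIdeles`) and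
whose base change (★ `TorusDict.pullback`) has some unitary archimedean type `(2e, 0)`.  WHY TRUE: Weil's extension principle for the anisotropic torus (module
docstring): the obstruction group `T(L⁺) ∩ (T_∞ · ∏_w T(𝒪_w))` is the finite cyclic `μ(L)` and the archimedean exponents absorb `χ_T|_{μ(L)}` (brick B3).  Why it might
fail: only through the strong reading of «spherical» at places `w ≠ v` ramified in `L∕L⁺` — which Weil's principle does deliver (level `∏_w T(𝒪_w)`).  Consumer reading on
`U(Φ₁)(L⁺_w)`: ★ `torusLocalComponent_eq_one_of_spherical` (non-split `w`) ∕ the split dictionary ★ `torusLocalComponent_eq_inv_localComponent_of_split`.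
[cite: Rogawski1990, §13.8 p. 217 l. 9–12] [cite: Weil1956, §1] [cite: Arthur2011Draft, d-p. 319 Remark 2] -/
def TorusCharExtendLetter (L : Type) [Field L] [NumberField L] [IsCMField L] (v : HeightOneSpectrum (𝓞 ↥(maximalRealSubfield L))) : Prop :=
  (∀ W : PlacesOver L v, IsCMField.complexConj L • W.1 = W.1) →
    ∀ (χT : ↥(normOneUnits (conjLocal L (IsCMField.complexConj L) v)) →* ℂˣ), Continuous (fun t => ((χT t : ℂˣ) : ℂ)) →
      ∃ (ψ : ↥(TorusDict.torus (IsCMField.complexConj L)) →ₜ* ℂˣ) (hψ : TorusDict.IsAutomorphic (IsCMField.complexConj L) ψ) (e : InfinitePlace L → ℤ),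
        torusLocalComponent L (IsCMField.complexConj L) v ψ = χT ∧
        (∀ w : HeightOneSpectrum (𝓞 ↥(maximalRealSubfield L)), w ≠ v → ∀ t : ↥(TorusDict.torus (IsCMField.complexConj L)),
          (t : ideleGroup L) ∈ IdeleHerbrand.localUnitIdeles (↥(maximalRealSubfield L)) L w → ψ t = 1) ∧
        (TorusDict.pullback (IsCMField.complexConj L) (Algebra.IsQuadraticExtension.finrank_eq_two _ L)
          (IsCMField.complexConj_ne_one (K := L)) ψ hψ).HasUnitaryArchType (fun w => 2 * e w) (fun _ => 0)

/-- Read-back, `Iff.rfl`. [cite: Rogawski1990, §13.8 p. 217 l. 9–12] -/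
theorem torusCharExtendLetter_iff (L : Type) [Field L] [NumberField L] [IsCMField L] (v : HeightOneSpectrum (𝓞 ↥(maximalRealSubfield L))) :
    TorusCharExtendLetter L v ↔
      ((∀ W : PlacesOver L v, IsCMField.complexConj L • W.1 = W.1) →
        ∀ (χT : ↥(normOneUnits (conjLocal L (IsCMField.complexConj L) v)) →* ℂˣ), Continuous (fun t => ((χT t : ℂˣ) : ℂ)) →
          ∃ (ψ : ↥(TorusDict.torus (IsCMField.complexConj L)) →ₜ* ℂˣ) (hψ : TorusDict.IsAutomorphic (IsCMField.complexConj L) ψ) (e : InfinitePlace L → ℤ),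
            torusLocalComponent L (IsCMField.complexConj L) v ψ = χT ∧
            (∀ w : HeightOneSpectrum (𝓞 ↥(maximalRealSubfield L)), w ≠ v → ∀ t : ↥(TorusDict.torus (IsCMField.complexConj L)),
              (t : ideleGroup L) ∈ IdeleHerbrand.localUnitIdeles (↥(maximalRealSubfield L)) L w → ψ t = 1) ∧
            (TorusDict.pullback (IsCMField.complexConj L) (Algebra.IsQuadraticExtension.finrank_eq_two _ L)
              (IsCMField.complexConj_ne_one (K := L)) ψ hψ).HasUnitaryArchType (fun w => 2 * e w) (fun _ => 0)) :=
  Iff.rfl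

end Summit.HodgeConjecture.HodgeConjecture.R90.S10

end
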